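import Literature.Computability.Cryptography.LWEPrimePowerAmplifier
import Literature.Computability.Cryptography.LWEPiLawMaps
import Literature.Computability.Cryptography.LWEBinaryHybridZero
import Literature.Probability.Distributions.ProductLawEvents
import HarnessLib

/-!
# BLPRS 2013, Lemma 2.15 (`LWE_{≤α} ⇒ LWE_α`): the estimate-and-flag test over finitely many noise guesses

Topic `Computability/Cryptography` (LWE), grouping namespace `BLPRS2013`. Proved glue (no named fact)
towards `Literature.Computability.Cryptography.blprs_gapSVP_sqrt_dim_to_lwe_classical` (**pqc.S21**),
hypothesis `h₃` of `BLPRSReduction.lean`. After Thm. 4.1 and Cor. 3.2 the samples handed to the given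
distinguisher have noise of an UNKNOWN rate `β(z) ≤ α` (it depends on the binary secret `z` only through
its Hamming weight, so it is one of `n + 1` known values); Lemma 2.15 removes the uncertainty:

> *"Lemma 2.15. Let `𝒜` be an algorithm for `LWE_{n,m,q,α}` with advantage at least `ε > 0`. Then there
> exists an algorithm `ℬ` for `LWE_{n,m',q,≤α}` using oracle access to `𝒜` and with advantage at least
> `1/3`, where both `m'` and its running time are `poly(m, 1/ε, n, log q)`. The proof is standard … The
> idea is to use Chernoff bound to estimate `𝒜`'s success probability on the uniform distribution, and
> then add noise in small increments to our given distribution and estimate `𝒜`'s behavior on the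
> resulting distributions. If there is a gap between any of these and the uniform behavior, the input
> distribution is deemed non-uniform."* (arXiv:1306.0281, p. 9–10.)

This file proves the law-level content of that test for a FINITE family of "noise guesses", in a form
that is generic in the per-guess transformation (so that the guesses can be the `n + 1` noise-raising
amounts of pqc.S21's chain, each composed with the modulus switch of `LWEModulusSwitchDiscrete.lean` and a
fresh secret shift): the input is a `G × N` array of blocks (`G` guesses, `N` batches each), block
`(w, i)` is sent through the kernel `κ w` and then through the given test `K`; `K` is also run on `N'`
self-generated reference blocks `U_Y`; the test ACCEPTS iff some row's empirical acceptance frequency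
differs from the reference frequency by more than `θ`:

* `rowBits`, `guessBits`, `refBits`, `GapAt`, `gapSet`, **`guessTest`** (the test), `flatGuessTest`
  (the same on a flat tuple of `G·(N·u)` samples, cut into blocks by the tree's `LWE.blocksOf`);
* law plumbing: `indepLaw_bind_indepLaw` (independent inputs through independent kernels),
  `piLaw_bind_piLaw`, `ansLaw_eq_iidPMF`, **`acceptProb_guessTest_eq`** (on iid blocks of law `P` the
  test accepts with the mass of `gapSet` under `(⨂_w Ans_N(K, P ≫= κ_w)) ⊗ Ans_{N'}(K, U_Y)`);
* **`acceptProb_guessTest_le`** (soundness): if every row law is `θ/2`-close to the reference in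
  acceptance probability, `Pr[accept] ≤ 4G/(Nθ²) + 4/(N'θ²)` (Chebyshev per row, union bound);
* **`le_acceptProb_guessTest`** (completeness): if SOME row `w₀` is `2θ`-far from the reference,
  `Pr[accept] ≥ 1 - 4/(Nθ²) - 4/(N'θ²)` — only the good row matters, the other rows are arbitrary;
  `le_acceptProb_guessTest_mixture` (the same for a mixture of iid inputs each having a good row, e.g.
  over the binary secret `z`);
* real-valued forms and the flat layout: `toReal_acceptProb_guessTest_le`,
  `le_toReal_acceptProb_guessTest_mixture`, `acceptProb_flatGuessTest_iidPMF`,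
  `acceptProb_flatGuessTest_mixture`, and the advantage form against the tree's `binLWE` hybrid
  **`advantage_flatGuessTest_hybridH₀`**: for `A = flatGuessTest`,
  `Pr[A(H₀(χ₀, ζ))] - Pr[A(U)] ≥ 1 - (4(G+1)/(Nθ²) + 8/(N'θ²))` whenever every uniform row is `θ/2`-close
  and every secret in the support of `ζ` has a `2θ`-far row (the input format of
  `LWE.blprs_theorem_4_1_bound`, `BLPRSThm41Skeleton.lean`).

## References

* Z. Brakerski, A. Langlois, C. Peikert, O. Regev, D. Stehlé, *Classical hardness of learning with
  errors*, STOC 2013; arXiv:1306.0281, Def. 2.14 and Lemma 2.15 (pp. 9–10), and p. 13 ("one also needs to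
  apply Lemma 2.15 to replace the 'unknown noise' variant"). [BrakerskiEtAl2013]
* O. Regev, *On lattices, learning with errors …*, J. ACM 56 (2009), Lemma 3.7 / Lemma 4.1 (the analogous
  estimation arguments). [RegevLWE2009]
-/

noncomputable section

open scoped ENNReal
open Literature.Probability.Distributions

namespace Literature.Computability.Cryptography

namespace BLPRS2013

open LWE LWE.MP12

/-! ### Law plumbing: independent inputs through independent kernels -/

section Laws

variable {α β : Type}

/-- **Independent inputs processed by independent kernels give independent outputs**:
`(⨂ⱼ μⱼ) ≫= (c ↦ ⨂ⱼ fⱼ(cⱼ)) = ⨂ⱼ (μⱼ ≫= fⱼ)`. [folklore] -/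
theorem indepLaw_bind_indepLaw (N : ℕ) (μ : Fin N → PMF α) (f : Fin N → α → PMF β) :
    ((indepLaw N μ).bind fun c => indepLaw N fun i => f i (c i)) = indepLaw N fun i => (μ i).bind (f i) := by
  have h := congrArg (PMF.map fun (v : Fin N → α × β) j => (v j).2) (indepLaw_bind_map_prodMk N μ f)
  rw [indepLaw_map_pi N _ (fun _ (p : α × β) => p.2), PMF.map_bind] at h
  have hl : (fun j => ((μ j).bind fun a => (f j a).map (Prod.mk a)).map (fun p : α × β => p.2)) =
      fun j => (μ j).bind (f j) := by
    funext j
    rw [PMF.map_bind]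
    refine congrArg _ (funext fun a => ?_)
    rw [PMF.map_comp]
    exact PMF.map_id _
  have hr : (fun c : Fin N → α => ((indepLaw N fun j => f j (c j)).map fun y j => (c j, y j)).map
      (fun (v : Fin N → α × β) j => (v j).2)) = fun c => indepLaw N fun j => f j (c j) := by
    funext c
    rw [PMF.map_comp]
    exact PMF.map_id _
  rw [hl, hr] at h
  exact h.symm

/-- **The same for `piLaw` over any finite index type.** [folklore] -/
theorem piLaw_bind_piLaw {ι : Type} [Fintype ι] [DecidableEq ι] [Fintype α] [Fintype β]
    (P : ι → PMF α) (F : ι → α → PMF β) :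
    ((piLaw P).bind fun f => piLaw fun i => F i (f i)) = piLaw fun i => (P i).bind (F i) := by
  classical
  ext g
  rw [PMF.bind_apply, tsum_fintype, piLaw_apply]
  simp_rw [piLaw_apply, PMF.bind_apply, tsum_fintype]
  rw [Finset.prod_univ_sum, Fintype.piFinset_univ]
  refine Finset.sum_congr rfl fun f _ => ?_
  rw [← Finset.prod_mul_distrib]

/-- **The verdict law of `N` iid blocks is the iid law of one verdict**: `Ans_N(K, P) = (P ≫= K)^{⊗N}`.
[folklore] -/
theorem ansLaw_eq_iidPMF {B : Type} (K : B → PMF Bool) (P : PMF B) (N : ℕ) :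
    ansLaw K P N = iidPMF (P.bind K) N := by
  rw [ansLaw, iidPMF_eq_indepLaw, iidPMF_eq_indepLaw, indepLaw_bind_indepLaw]

/-- Coordinatewise map of an iid tuple. [folklore] -/
theorem iidPMF_map_pi (p : PMF α) (f : α → β) (K : ℕ) :
    (iidPMF p K).map (fun v j => f (v j)) = iidPMF (p.map f) K := by
  rw [iidPMF_eq_indepLaw, iidPMF_eq_indepLaw, indepLaw_map_pi K _ (fun _ => f)]

/-- Pairing with an independent second component commutes with a first-stage draw. [folklore] -/
theorem bind_prodLaw {γ δ : Type} (p : PMF γ) (f : γ → PMF α) (r : PMF δ) :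
    (p.bind fun a => prodLaw (f a) r) = prodLaw (p.bind f) r := by
  show _ = (p.bind f).bind fun b => r.map (Prod.mk b)
  rw [PMF.bind_bind]
  rfl

end Laws

/-! ### The test -/

section GuessTest

variable {X Y : Type} [Fintype X] [Fintype Y]
variable (K : Y → PMF Bool) {G : ℕ} (κ : Fin G → X → PMF Y) (UY : PMF Y) (N N' : ℕ) (θ : ℝ)

/-- The verdict bits of row `w`: block `i` through the kernel `κ w`, then the test `K`, independently.
[cite: BrakerskiEtAl2013, Lemma 2.15 (proof sketch: "estimate `𝒜`'s behavior on the resulting distributions")] -/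
def rowBits (w : Fin G) (Sw : Fin N → X) : PMF (Fin N → Bool) :=
  indepLaw N fun i => (κ w (Sw i)).bind K

/-- All rows (independent). [cite: BrakerskiEtAl2013, Lemma 2.15 (proof sketch)] -/
def guessBits (S : Fin G → Fin N → X) : PMF (Fin G → Fin N → Bool) :=
  piLaw fun w => rowBits K κ N w (S w)

/-- The reference bits: `N'` runs of `K` on self-generated reference blocks `U_Y`.
[cite: BrakerskiEtAl2013, Lemma 2.15 (proof sketch: "estimate `𝒜`'s success probability on the uniform distribution")] -/
def refBits : PMF (Fin N' → Bool) :=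
  ansLaw K UY N'

/-- Row `w` shows a gap: `|cnt_w/N - cnt_ref/N'| > θ`, cleared of denominators. [cite: BrakerskiEtAl2013, Lemma 2.15 (proof sketch: "If there is a gap …")] -/
def GapAt (v : (Fin G → Fin N → Bool) × (Fin N' → Bool)) (w : Fin G) : Prop :=
  (N : ℝ) * N' * θ < |(N' : ℝ) * cnt (v.1 w) - N * cnt v.2|

/-- The acceptance event: some row shows a gap. [cite: BrakerskiEtAl2013, Lemma 2.15 (proof sketch)] -/
def gapSet : Set ((Fin G → Fin N → Bool) × (Fin N' → Bool)) :=
  {v | ∃ w, GapAt N N' θ v w}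

open Classical in
/-- **The estimate-and-flag test of Lemma 2.15** on a `G × N` array of blocks: accept iff some row's
acceptance frequency is more than `θ` away from the reference frequency. [cite: BrakerskiEtAl2013, Lemma 2.15] -/
def guessTest (S : Fin G → Fin N → X) : PMF Bool :=
  (prodLaw (guessBits K κ N S) (refBits K UY N')).map fun v => decide (v ∈ gapSet N N' θ)

variable {K κ UY N N' θ}

omit [Fintype X] [Fintype Y] in
/-- The test accepts with the mass of the gap event. [folklore] -/
theorem guessTest_apply_true (S : Fin G → Fin N → X) :
    guessTest K κ UY N N' θ S true = (prodLaw (guessBits K κ N S) (refBits K UY N')).toOuterMeasure (gapSet N N' θ) := by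
  classical
  rw [guessTest, ← PMF.toOuterMeasure_apply_singleton, PMF.toOuterMeasure_map_apply]
  congr 1
  ext v
  simp

omit [Fintype Y] in
/-- **The law of the whole measurement on iid blocks of law `P`**: the rows are independent, row `w` is
`Ans_N(K, P ≫= κ_w)`, the reference is `Ans_{N'}(K, U_Y)`. [cite: BrakerskiEtAl2013, Lemma 2.15 (proof sketch)] -/
theorem bind_guessBits_eq (P : PMF X) :
    ((piLaw fun _ : Fin G => iidPMF P N).bind (guessBits K κ N)) = piLaw fun w => ansLaw K (P.bind (κ w)) N := by
  unfold guessBits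
  rw [piLaw_bind_piLaw]
  refine congrArg piLaw (funext fun w => ?_)
  unfold rowBits
  rw [iidPMF_eq_indepLaw, ansLaw_eq_iidPMF, iidPMF_eq_indepLaw]
  have h := indepLaw_bind_indepLaw N (fun _ => P) (fun _ x => (κ w x).bind K)
  rw [h]
  simp only [PMF.bind_bind]

omit [Fintype Y] in
/-- **The acceptance probability on iid blocks of law `P`.** [cite: BrakerskiEtAl2013, Lemma 2.15 (proof sketch)] -/
theorem acceptProb_guessTest_eq (P : PMF X) :
    acceptProb (guessTest K κ UY N N' θ) (piLaw fun _ : Fin G => iidPMF P N) =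
      (prodLaw (piLaw fun w => ansLaw K (P.bind (κ w)) N) (refBits K UY N')).toOuterMeasure (gapSet N N' θ) := by
  classical
  have h : (piLaw fun _ : Fin G => iidPMF P N).bind (guessTest K κ UY N N' θ) =
      (prodLaw (piLaw fun w => ansLaw K (P.bind (κ w)) N) (refBits K UY N')).map fun v => decide (v ∈ gapSet N N' θ) := by
    unfold guessTest
    rw [← PMF.map_bind, bind_prodLaw, bind_guessBits_eq]
  rw [acceptProb, h, ← PMF.toOuterMeasure_apply_singleton, PMF.toOuterMeasure_map_apply]
  congr 1
  ext v
  simp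

/-- Chebyshev for one row (the deviation event `LWE.MP12.Dev N θ p = {Nθ/4 ≤ |cnt - Np|}` of
`LWEPrimePowerAmplifier.lean`): `Pr[Dev] ≤ 4/(Nθ²)`. [cite: BrakerskiEtAl2013, Lemma 2.15 (proof sketch: "Chernoff bound"; Chebyshev suffices)] -/
theorem prob_dev_le (P : PMF Y) (hN : 0 < N) (hθ : 0 < θ) :
    (ansLaw K P N).toOuterMeasure (Dev N θ (pacc K P)) ≤ ENNReal.ofReal (4 / (N * θ ^ 2)) := by
  refine (prob_cnt_dev_le K P hN (by positivity : 0 < θ / 4)).trans (le_of_eq ?_)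
  congr 1
  have hNr : (N : ℝ) ≠ 0 := by positivity
  field_simp

/-- Outside all deviation events there is no gap when every row mean is `θ/2`-close to the reference mean.
[folklore] -/
theorem not_gapAt_of_close {p : Fin G → ℝ} {pU : ℝ} (hN : 0 < N) (hN' : 0 < N')
    (hclose : ∀ w, |p w - pU| ≤ θ / 2) {v : (Fin G → Fin N → Bool) × (Fin N' → Bool)}
    (h1 : ∀ w, v.1 w ∉ Dev N θ (p w)) (h2 : v.2 ∉ Dev N' θ pU) (w : Fin G) : ¬ GapAt N N' θ v w := by
  unfold GapAt
  rw [not_lt]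
  have hNr : (0 : ℝ) < N := by exact_mod_cast hN
  have hN'r : (0 : ℝ) < N' := by exact_mod_cast hN'
  have e1 : |cnt (v.1 w) - N * p w| < N * (θ / 4) := by
    have := h1 w
    simp only [Dev, Set.mem_setOf_eq, not_le] at this
    exact this
  have e2 : |cnt v.2 - N' * pU| < N' * (θ / 4) := by
    simp only [Dev, Set.mem_setOf_eq, not_le] at h2
    exact h2
  have hsplit : (N' : ℝ) * cnt (v.1 w) - N * cnt v.2 =
      N' * (cnt (v.1 w) - N * p w) + N * N' * (p w - pU) - N * (cnt v.2 - N' * pU) := by ring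
  rw [hsplit]
  calc |(N' : ℝ) * (cnt (v.1 w) - N * p w) + N * N' * (p w - pU) - N * (cnt v.2 - N' * pU)|
      ≤ |(N' : ℝ) * (cnt (v.1 w) - N * p w) + N * N' * (p w - pU)| + |(N : ℝ) * (cnt v.2 - N' * pU)| := abs_sub _ _
    _ ≤ |(N' : ℝ) * (cnt (v.1 w) - N * p w)| + |(N : ℝ) * N' * (p w - pU)| + |(N : ℝ) * (cnt v.2 - N' * pU)| := by
        gcongr; exact abs_add_le _ _
    _ = N' * |cnt (v.1 w) - N * p w| + N * N' * |p w - pU| + N * |cnt v.2 - N' * pU| := by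
        simp only [abs_mul, abs_of_pos hN'r, abs_of_pos hNr]
    _ ≤ N' * (N * (θ / 4)) + N * N' * (θ / 2) + N * (N' * (θ / 4)) := by
        gcongr
        exact hclose w
    _ = N * N' * θ := by ring

/-- Outside the two deviation events of a `2θ`-far row there IS a gap. [folklore] -/
theorem gapAt_of_far {p pU : ℝ} (hN : 0 < N) (hN' : 0 < N') (hθ : 0 < θ) {w : Fin G} (hfar : 2 * θ ≤ |p - pU|)
    {v : (Fin G → Fin N → Bool) × (Fin N' → Bool)} (h1 : v.1 w ∉ Dev N θ p) (h2 : v.2 ∉ Dev N' θ pU) :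
    GapAt N N' θ v w := by
  unfold GapAt
  have hNr : (0 : ℝ) < N := by exact_mod_cast hN
  have hN'r : (0 : ℝ) < N' := by exact_mod_cast hN'
  have e1 : |cnt (v.1 w) - N * p| < N * (θ / 4) := by
    simp only [Dev, Set.mem_setOf_eq, not_le] at h1
    exact h1
  have e2 : |cnt v.2 - N' * pU| < N' * (θ / 4) := by
    simp only [Dev, Set.mem_setOf_eq, not_le] at h2
    exact h2
  have hsplit : (N : ℝ) * N' * (p - pU) =
      (N' * cnt (v.1 w) - N * cnt v.2) - N' * (cnt (v.1 w) - N * p) + N * (cnt v.2 - N' * pU) := by ring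
  have hmain : (N : ℝ) * N' * |p - pU| ≤ |(N' : ℝ) * cnt (v.1 w) - N * cnt v.2| + N' * |cnt (v.1 w) - N * p| + N * |cnt v.2 - N' * pU| := by
    calc (N : ℝ) * N' * |p - pU| = |(N : ℝ) * N' * (p - pU)| := by
          simp only [abs_mul, abs_of_pos hNr, abs_of_pos hN'r]
      _ = |(N' * cnt (v.1 w) - N * cnt v.2) - N' * (cnt (v.1 w) - N * p) + N * (cnt v.2 - N' * pU)| := by rw [hsplit]
      _ ≤ |(N' * cnt (v.1 w) - N * cnt v.2) - N' * (cnt (v.1 w) - N * p)| + |(N : ℝ) * (cnt v.2 - N' * pU)| := abs_add_le _ _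
      _ ≤ |(N' : ℝ) * cnt (v.1 w) - N * cnt v.2| + |(N' : ℝ) * (cnt (v.1 w) - N * p)| + |(N : ℝ) * (cnt v.2 - N' * pU)| := by
          gcongr; exact abs_sub _ _
      _ = _ := by simp only [abs_mul, abs_of_pos hNr, abs_of_pos hN'r]
  have h3 : (N : ℝ) * N' * (2 * θ) ≤ N * N' * |p - pU| := mul_le_mul_of_nonneg_left hfar (by positivity)
  have f1 : (N' : ℝ) * |cnt (v.1 w) - N * p| ≤ N' * (N * (θ / 4)) := mul_le_mul_of_nonneg_left e1.le hN'r.le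
  have f2 : (N : ℝ) * |cnt v.2 - N' * pU| ≤ N * (N' * (θ / 4)) := mul_le_mul_of_nonneg_left e2.le hNr.le
  have f3 : (0 : ℝ) < N * N' * θ := by positivity
  nlinarith [f1, f2, f3, hmain, h3]

/-- **Soundness of the test (the reference side)**: if on iid blocks of law `P` EVERY row's acceptance
probability is within `θ/2` of the reference acceptance probability `pacc K U_Y`, the test accepts with
probability at most `4G/(Nθ²) + 4/(N'θ²)` (Chebyshev on each of the `G` rows and on the reference, union
bound). [cite: BrakerskiEtAl2013, Lemma 2.15 (proof sketch)] -/
theorem acceptProb_guessTest_le (P : PMF X) (hN : 0 < N) (hN' : 0 < N') (hθ : 0 < θ)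
    (hclose : ∀ w, |pacc K (P.bind (κ w)) - pacc K UY| ≤ θ / 2) :
    acceptProb (guessTest K κ UY N N' θ) (piLaw fun _ : Fin G => iidPMF P N) ≤
      G * ENNReal.ofReal (4 / (N * θ ^ 2)) + ENNReal.ofReal (4 / (N' * θ ^ 2)) := by
  rw [acceptProb_guessTest_eq]
  -- the gap event is covered by the deviation events
  have hcover : gapSet N N' θ ⊆
      (Prod.fst ⁻¹' {a : Fin G → Fin N → Bool | ∃ w, a w ∈ Dev N θ (pacc K (P.bind (κ w)))}) ∪
        (Prod.snd ⁻¹' Dev N' θ (pacc K UY)) := by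
    intro v hv
    by_contra hnot
    simp only [Set.mem_union, Set.mem_preimage, Set.mem_setOf_eq, not_or, not_exists] at hnot
    obtain ⟨w, hw⟩ := hv
    exact not_gapAt_of_close hN hN' hclose (v := v) (fun w h => hnot.1 w (by exact h)) hnot.2 w hw
  refine (MeasureTheory.measure_mono hcover).trans ((MeasureTheory.measure_union_le _ _).trans ?_)
  refine add_le_add ?_ ?_
  · rw [← PMF.toOuterMeasure_map_apply, prodLaw_map_fst]
    refine (piLaw_toOuterMeasure_exists_mem_le _ _).trans ?_
    calc ∑ w : Fin G, (ansLaw K (P.bind (κ w)) N).toOuterMeasure (Dev N θ (pacc K (P.bind (κ w))))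
        ≤ ∑ _w : Fin G, ENNReal.ofReal (4 / (N * θ ^ 2)) := Finset.sum_le_sum fun w _ => prob_dev_le _ hN hθ
      _ = G * ENNReal.ofReal (4 / (N * θ ^ 2)) := by
          rw [Finset.sum_const, Finset.card_univ, Fintype.card_fin, nsmul_eq_mul]
  · rw [← PMF.toOuterMeasure_map_apply, prodLaw_map_snd]
    exact prob_dev_le _ hN' hθ

/-- **Completeness of the test (the far side)**: if on iid blocks of law `P` SOME row `w₀` has acceptance
probability at least `2θ` away from the reference, the test accepts with probability at least
`1 - 4/(Nθ²) - 4/(N'θ²)` — whatever the other rows do. [cite: BrakerskiEtAl2013, Lemma 2.15 (proof sketch)] -/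
theorem le_acceptProb_guessTest (P : PMF X) (hN : 0 < N) (hN' : 0 < N') (hθ : 0 < θ) {w₀ : Fin G}
    (hfar : 2 * θ ≤ |pacc K (P.bind (κ w₀)) - pacc K UY|) :
    1 - (ENNReal.ofReal (4 / (N * θ ^ 2)) + ENNReal.ofReal (4 / (N' * θ ^ 2))) ≤
      acceptProb (guessTest K κ UY N N' θ) (piLaw fun _ : Fin G => iidPMF P N) := by
  rw [acceptProb_guessTest_eq]
  refine one_sub_le_toOuterMeasure_of_compl_le _ _ ?_
  have hcover : (gapSet N N' θ)ᶜ ⊆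
      (Prod.fst ⁻¹' {a : Fin G → Fin N → Bool | a w₀ ∈ Dev N θ (pacc K (P.bind (κ w₀)))}) ∪
        (Prod.snd ⁻¹' Dev N' θ (pacc K UY)) := by
    intro v hv
    by_contra hnot
    simp only [Set.mem_union, Set.mem_preimage, Set.mem_setOf_eq, not_or] at hnot
    exact hv ⟨w₀, gapAt_of_far hN hN' hθ hfar (v := v) (by exact hnot.1) hnot.2⟩
  refine (MeasureTheory.measure_mono hcover).trans ((MeasureTheory.measure_union_le _ _).trans ?_)
  refine add_le_add ?_ ?_
  · rw [← PMF.toOuterMeasure_map_apply, prodLaw_map_fst,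
      piLaw_toOuterMeasure_eval_mem (fun w => ansLaw K (P.bind (κ w)) N) w₀ (Dev N θ (pacc K (P.bind (κ w₀))))]
    exact prob_dev_le _ hN hθ
  · rw [← PMF.toOuterMeasure_map_apply, prodLaw_map_snd]
    exact prob_dev_le _ hN' hθ

/-- **Completeness on a mixture**: if the input is a mixture (over `z ← ζ`, e.g. the binary secret) of iid
block laws `P z`, each having a `2θ`-far row, the same lower bound holds. [cite: BrakerskiEtAl2013, Lemma 2.15 with Def. 2.14 ("`β` possibly depending on the secret")] -/
theorem le_acceptProb_guessTest_mixture {Z : Type} (ζ : PMF Z) (P : Z → PMF X) (hN : 0 < N) (hN' : 0 < N') (hθ : 0 < θ)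
    (hfar : ∀ z ∈ ζ.support, ∃ w₀ : Fin G, 2 * θ ≤ |pacc K ((P z).bind (κ w₀)) - pacc K UY|) :
    1 - (ENNReal.ofReal (4 / (N * θ ^ 2)) + ENNReal.ofReal (4 / (N' * θ ^ 2))) ≤
      acceptProb (guessTest K κ UY N N' θ) (ζ.bind fun z => piLaw fun _ : Fin G => iidPMF (P z) N) := by
  set δ := ENNReal.ofReal (4 / (N * θ ^ 2)) + ENNReal.ofReal (4 / (N' * θ ^ 2)) with hδ
  rw [acceptProb, PMF.bind_bind, PMF.bind_apply]
  have hz : ∀ z, ζ z * (1 - δ) ≤ ζ z * ((piLaw fun _ : Fin G => iidPMF (P z) N).bind (guessTest K κ UY N N' θ)) true := by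
    intro z
    by_cases h0 : ζ z = 0
    · rw [h0, zero_mul, zero_mul]
    · obtain ⟨w₀, hw₀⟩ := hfar z ((PMF.mem_support_iff _ _).2 h0)
      have h := le_acceptProb_guessTest (K := K) (κ := κ) (UY := UY) (N := N) (N' := N') (θ := θ) (P z) hN hN' hθ hw₀
      gcongr
      exact h
  calc 1 - δ = ∑' z, ζ z * (1 - δ) := by rw [ENNReal.tsum_mul_right, PMF.tsum_coe, one_mul]
    _ ≤ _ := ENNReal.tsum_le_tsum hz

/-! ### Real-valued forms -/

/-- Soundness, real-valued. [cite: BrakerskiEtAl2013, Lemma 2.15] -/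
theorem toReal_acceptProb_guessTest_le (P : PMF X) (hN : 0 < N) (hN' : 0 < N') (hθ : 0 < θ)
    (hclose : ∀ w, |pacc K (P.bind (κ w)) - pacc K UY| ≤ θ / 2) :
    (acceptProb (guessTest K κ UY N N' θ) (piLaw fun _ : Fin G => iidPMF P N)).toReal ≤
      G * (4 / (N * θ ^ 2)) + 4 / (N' * θ ^ 2) := by
  have h := acceptProb_guessTest_le P hN hN' hθ hclose
  have h4 : (0 : ℝ) ≤ 4 / (N * θ ^ 2) := by positivity
  have h4' : (0 : ℝ) ≤ 4 / (N' * θ ^ 2) := by positivity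
  have hfin : (G : ℝ≥0∞) * ENNReal.ofReal (4 / (N * θ ^ 2)) + ENNReal.ofReal (4 / (N' * θ ^ 2)) ≠ ⊤ :=
    ENNReal.add_ne_top.2 ⟨ENNReal.mul_ne_top (ENNReal.natCast_ne_top G) ENNReal.ofReal_ne_top, ENNReal.ofReal_ne_top⟩
  calc (acceptProb (guessTest K κ UY N N' θ) (piLaw fun _ : Fin G => iidPMF P N)).toReal
      ≤ ((G : ℝ≥0∞) * ENNReal.ofReal (4 / (N * θ ^ 2)) + ENNReal.ofReal (4 / (N' * θ ^ 2))).toReal :=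
        ENNReal.toReal_mono hfin h
    _ = G * (4 / (N * θ ^ 2)) + 4 / (N' * θ ^ 2) := by
        rw [ENNReal.toReal_add (ENNReal.mul_ne_top (ENNReal.natCast_ne_top G) ENNReal.ofReal_ne_top) ENNReal.ofReal_ne_top,
          ENNReal.toReal_mul, ENNReal.toReal_natCast, ENNReal.toReal_ofReal h4, ENNReal.toReal_ofReal h4']

/-- `1 - d ≤ a.toReal` from `1 - ofReal d ≤ a ≤ 1`. [folklore] -/
theorem one_sub_le_toReal_of_le {a : ℝ≥0∞} {d : ℝ} (hd : 0 ≤ d) (ha : a ≤ 1) (h : 1 - ENNReal.ofReal d ≤ a) :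
    1 - d ≤ a.toReal := by
  by_cases hd1 : 1 ≤ d
  · linarith [ENNReal.toReal_nonneg (a := a)]
  · have hlt : ENNReal.ofReal d ≤ 1 := by
      rw [← ENNReal.ofReal_one]; exact ENNReal.ofReal_le_ofReal (by linarith)
    have := ENNReal.toReal_mono (ne_top_of_le_ne_top ENNReal.one_ne_top ha) h
    rwa [ENNReal.toReal_sub_of_le hlt ENNReal.one_ne_top, ENNReal.toReal_one, ENNReal.toReal_ofReal hd] at this

/-- Completeness on a mixture, real-valued. [cite: BrakerskiEtAl2013, Lemma 2.15] -/
theorem le_toReal_acceptProb_guessTest_mixture {Z : Type} (ζ : PMF Z) (P : Z → PMF X) (hN : 0 < N) (hN' : 0 < N')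
    (hθ : 0 < θ) (hfar : ∀ z ∈ ζ.support, ∃ w₀ : Fin G, 2 * θ ≤ |pacc K ((P z).bind (κ w₀)) - pacc K UY|) :
    1 - (4 / (N * θ ^ 2) + 4 / (N' * θ ^ 2)) ≤
      (acceptProb (guessTest K κ UY N N' θ) (ζ.bind fun z => piLaw fun _ : Fin G => iidPMF (P z) N)).toReal := by
  have h := le_acceptProb_guessTest_mixture ζ P hN hN' hθ hfar
  have h4 : (0 : ℝ) ≤ 4 / (N * θ ^ 2) := by positivity
  have h4' : (0 : ℝ) ≤ 4 / (N' * θ ^ 2) := by positivity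
  rw [← ENNReal.ofReal_add h4 h4'] at h
  exact one_sub_le_toReal_of_le (by positivity) (acceptProb_le_one _ _) h

end GuessTest

/-! ### The flat layout: a tuple of `G·(N·u)` samples cut into `G × N` blocks of `u` samples -/

section Flat

variable {X₀ Y : Type} [Fintype X₀]
variable (K : Y → PMF Bool) {G : ℕ} (N u : ℕ) (κ : Fin G → (Fin u → X₀) → PMF Y) (UY : PMF Y) (N' : ℕ) (θ : ℝ)

/-- **The test on a flat tuple of samples**: row `w`, batch `i`, position `j` is sample `w·(N·u) + i·u + j`
(the tree's `LWE.blocksOf`, twice). [cite: BrakerskiEtAl2013, Lemma 2.15 ("using `m' = poly(m, 1/ε, n, log q)` samples")] -/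
def flatGuessTest (S : Fin (G * (N * u)) → X₀) : PMF Bool :=
  guessTest K κ UY N N' θ fun w => blocksOf N u (blocksOf G (N * u) S w)

variable {K N u κ UY N' θ}

/-- Cutting an iid tuple into the `G × N` array of `u`-blocks gives iid blocks. [folklore] -/
theorem iidPMF_map_blocks (p : PMF X₀) :
    (iidPMF p (G * (N * u))).map (fun S w => blocksOf N u (blocksOf G (N * u) S w)) =
      piLaw fun _ : Fin G => iidPMF (iidPMF p u) N := by
  have hcomp : (fun (S : Fin (G * (N * u)) → X₀) w => blocksOf N u (blocksOf G (N * u) S w)) =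
      (fun (v : Fin G → Fin (N * u) → X₀) w => blocksOf N u (v w)) ∘ blocksOf G (N * u) := rfl
  rw [hcomp, ← PMF.map_comp, iidPMF_map_blocksOf, iidPMF_map_pi, iidPMF_map_blocksOf, ← piLaw_const_eq_iidPMF]

/-- **On an iid tuple the flat test is the array test on iid blocks.** [folklore] -/
theorem acceptProb_flatGuessTest_iidPMF (p : PMF X₀) :
    acceptProb (flatGuessTest K N u κ UY N' θ) (iidPMF p (G * (N * u))) =
      acceptProb (guessTest K κ UY N N' θ) (piLaw fun _ : Fin G => iidPMF (iidPMF p u) N) := by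
  rw [acceptProb, acceptProb, ← iidPMF_map_blocks, PMF.bind_map]
  rfl

/-- The same for a mixture of iid tuples. [folklore] -/
theorem acceptProb_flatGuessTest_mixture {Z : Type} (ζ : PMF Z) (p : Z → PMF X₀) :
    acceptProb (flatGuessTest K N u κ UY N' θ) (ζ.bind fun z => iidPMF (p z) (G * (N * u))) =
      acceptProb (guessTest K κ UY N N' θ) (ζ.bind fun z => piLaw fun _ : Fin G => iidPMF (iidPMF (p z) u) N) := by
  rw [acceptProb, acceptProb, PMF.bind_bind, PMF.bind_bind]
  congr 1
  refine congrArg _ (funext fun z => ?_)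
  rw [← iidPMF_map_blocks, PMF.bind_map]
  rfl

end Flat

/-! ### The advantage against the binary-secret hybrid `H₀` of Thm. 4.1 -/

section BinLWE

variable {R : Type} [CommRing R] [Fintype R] {Y : Type} [Fintype Y] {n u G : ℕ}
variable (K : Y → PMF Bool) (N : ℕ) (κ : Fin G → (Fin u → (Fin n → R) × R) → PMF Y) (UY : PMF Y) (N' : ℕ) (θ : ℝ)

/-- **Lemma 2.15's test in front of Thm. 4.1**: if every row of the reduction maps uniform `u`-blocks to
within `θ/2` of the reference in `K`-acceptance, and for every binary secret `z` in the support of `ζ` some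
row maps `A_{z̄,χ₀(z̄)}`-blocks to at least `2θ` away, then the flat test `A` on `m = G·(N·u)` samples has
`Pr[A(H₀(χ₀, m, ζ))] - Pr[A(U^m)] ≥ 1 - (4(G+1)/(Nθ²) + 8/(N'θ²))` — the left-hand side of
`LWE.blprs_theorem_4_1_bound`. [cite: BrakerskiEtAl2013, Lemma 2.15 with Thm. 4.1 and p. 13] -/
theorem advantage_flatGuessTest_hybridH₀ (χ₀ : (Fin n → R) → PMF R) (ζ : PMF (Fin n → ℤ)) (hN : 0 < N) (hN' : 0 < N')
    (hθ : 0 < θ)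
    (hU : ∀ w, |pacc K ((uniformSamples (Fin n) R u).bind (κ w)) - pacc K UY| ≤ θ / 2)
    (hL : ∀ z ∈ ζ.support, ∃ w₀ : Fin G,
      2 * θ ≤ |pacc K ((lweSamples (χ₀ (intCastVec z)) (intCastVec z : Fin n → R) u).bind (κ w₀)) - pacc K UY|) :
    1 - ((G + 1) * (4 / (N * θ ^ 2)) + 8 / (N' * θ ^ 2)) ≤
      (acceptProb (flatGuessTest K N u κ UY N' θ) (hybridH₀ χ₀ (G * (N * u)) ζ)).toReal -
        (acceptProb (flatGuessTest K N u κ UY N' θ) (uniformSamples (Fin n) R (G * (N * u)))).toReal := by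
  -- the `binLWE` side: a mixture over `z` of iid tuples
  have hL' : 1 - (4 / (N * θ ^ 2) + 4 / (N' * θ ^ 2)) ≤
      (acceptProb (flatGuessTest K N u κ UY N' θ) (hybridH₀ χ₀ (G * (N * u)) ζ)).toReal := by
    have h := le_toReal_acceptProb_guessTest_mixture (K := K) (κ := κ) (UY := UY) (N := N) (N' := N') (θ := θ) ζ
      (fun z => lweSamples (χ₀ (intCastVec z)) (intCastVec z : Fin n → R) u) hN hN' hθ hL
    rwa [hybridH₀, show (fun z : Fin n → ℤ => lweSamples (χ₀ (intCastVec z)) (intCastVec z : Fin n → R) (G * (N * u))) =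
      fun z => iidPMF (lweSample (χ₀ (intCastVec z)) (intCastVec z : Fin n → R)) (G * (N * u)) from rfl,
      acceptProb_flatGuessTest_mixture]
  -- the uniform side: an iid tuple of uniform samples
  have hU' : (acceptProb (flatGuessTest K N u κ UY N' θ) (uniformSamples (Fin n) R (G * (N * u)))).toReal ≤
      G * (4 / (N * θ ^ 2)) + 4 / (N' * θ ^ 2) := by
    have h := toReal_acceptProb_guessTest_le (K := K) (κ := κ) (UY := UY) (N := N) (N' := N') (θ := θ)
      (uniformSamples (Fin n) R u) hN hN' hθ hU
    rw [uniformSamples_eq_iidPMF_holds] at h ⊢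
    rwa [acceptProb_flatGuessTest_iidPMF]
  have : (G + 1) * (4 / (N * θ ^ 2)) + 8 / (N' * θ ^ 2) =
      (4 / (N * θ ^ 2) + 4 / (N' * θ ^ 2)) + (G * (4 / (N * θ ^ 2)) + 4 / (N' * θ ^ 2)) := by ring
  rw [this]
  linarith

end BinLWE

end BLPRS2013

end Literature.Computability.Cryptography

end
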